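import Mathlib.Analysis.SpecialFunctions.Pow.Asymptotics
import Literature.NumberTheory.LFunctions.ZeroDensityInghamHuxleyProofs
import Literature.NumberTheory.LFunctions.GuthMaynardZeroDetection
import HarnessLib

/-!
# Tools for the log-power density theorem near `σ = 1`: no class (ii) zeros (Weyl's bound), and the zeros of logarithmic height

NOT RH-BEARING (D-0040; rh-crit cell C4, bears_on LADDER-RH §4 HELD row `DensityLadder`, road B of
the near-`σ = 1` density bound `ZeroDensityNearOneLogPower.lean`): a zero-density theorem COUNTS zeros
off the critical line, it never empties the strip (Barrier
`Literature.Barriers.RiemannHypothesis.LindelofBacklund`); everything here is RH-FREE literature and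
nothing in this file is worded as, or is, progress toward RH.

Topic `Literature/NumberTheory/LFunctions`; namespace `Literature.NumberTheory.LFunctions.NearOneLogPower`.
THEOREMS only (no definition, no named fact, no `sorry`).

## What is proved, and where it comes from

The zero-detection method (Huxley, *The Distribution of Prime Numbers* (1972), Ch. 23 and Ch. 28,
(28.3)–(28.4); Ivić, *The Riemann Zeta-Function* (1985), §11.2–§11.3) splits the zeros
`ρ = β + iγ`, `β ≥ 1/2 + δ`, `100 log T ≤ γ ≤ T` into class (i) (a Dirichlet polynomial
`∑_{X<n≤100 l Y} a_X(n)e^{-n/Y}n^{-ρ}` is large) and class (ii), whose condition the tree keeps as the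
short integral `∫_{|y| ≤ 100 log T} |ζ(1/2+i(γ+y)) M_X(1/2+i(γ+y))| dy ≥ 2⁻²⁰ δ Y^{β−1/2}`
(`HuxleyZeroDensity.zeroDetection_integral`). In Ivić's proof of the `12/5`-theorem (Thm. 11.1,
proof of (11.23)) the class (ii) zeros are ABSENT for `σ > 5/6` because of an upper bound for
`ζ(1/2+it)` of order `t^{1/6+o(1)}` ("`M(12) ≤ 2`"; in the tree: Weyl's bound, Titchmarsh Thm. 5.12,
`norm_riemannZeta_half_le_weyl`, used in `HuxleyIvic.integral_lt_of_weyl` with `X ≤ 2T^η`). For the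
log-power density theorem near `σ = 1` the mollifier length is a fixed power `X = T^{11/20}`, so the
bookkeeping of `HuxleyIvic.integral_lt_of_weyl` (`‖M_X‖ ≤ X`, `X ≤ 2T^η`) is replaced by
`‖M_X(1/2+it)‖ ≤ 2√X` (`GuthMaynardZeroDensity.norm_mollifier_half_le`):

  `∫_{|y|≤100 l} |ζ M_X(1/2+i(γ+y))| dy ≤ 2·(100 l)·(4|C_W| T^{1/6} l)·(2√X) ≤ 800·4|C_W|·l²·T^{1/6+a/2}`
  for `X ≤ 2T^{a}`, `200 l ≤ γ ≤ T`, `l = log T`,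

which is `< c T^{v}` for `T ≥ T₀(a, v, c)` as soon as `1/6 + a/2 < v` (`integral_zetaMoll_lt_of_weyl`).
At `a = 11/20`, `v = 9/20 = 54/120 > 53/120 = 1/6 + 11/40`, `c = (9/20)/2²⁰` this kills the class
(ii) alternative of `zeroDetection_integral` run with `δ = 9/20`, `Y = T` for every zero with
`β ≥ 19/20` (`classTwo_empty_of_weyl`, `not_classTwo_of_weyl`), so that EVERY such zero of the block
`T/2 < γ ≤ T` is of class (i) (`classOne_of_zero`). The zeros of height `≤ k log T` number
`≪_k log T · log log T` (`zetaZeroCountRe_logHeight_le`, from the tree's unconditional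
`N(σ, T) ≤ C (T+2) log(T+2)`, `exists_zetaZeroCountRe_le_mul_log`, Jensen).

Main statements (all proved):
* `norm_zeta_half_le_of_weyl_window` — `‖ζ(1/2+it)‖ ≤ C T^{1/6} log T` for `100 log T ≤ t ≤ 2T`, `T ≥ T₀`;
* `integral_zetaMoll_lt_sqrt` — `HuxleyIvic.integral_zetaMoll_lt` with `2√X` in place of `X`;
* `integral_zetaMoll_lt_of_weyl` (general exponents `1/6 + a/2 < v`, heights `200 log T ≤ γ ≤ T`),
  `integral_zetaMoll_lt_of_weyl_block` (heights `T/2 < γ ≤ T`);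
* `classTwo_empty_of_weyl`, `not_classTwo_of_weyl`, `classOne_of_zero` (`X ≤ 2T^{11/20}`, `Y = T`,
  `δ = 9/20`, `β ≥ 19/20`);
* `zetaZeroCountRe_logHeight_le` — `N(σ, k log T) ≤ C log T · log log T` (`T ≥ T₀(k)`, `σ ≥ 1/4`).

WHAT THIS IS NOT: not a density theorem by itself, not a route, not an RH residual; no statement
about zeros ON the critical line.

## References

* A. Ivić, *The Riemann Zeta-Function*, Wiley 1985, Thm. 11.1, proof of (11.23) (class (ii) empty
  for `σ > 5/6` by a bound for `ζ(1/2+it)`), §11.1 (`N(σ,T) ≪ T log T`). [Ivic1985]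
* M. N. Huxley, *The Distribution of Prime Numbers*, Oxford 1972, Ch. 28, (28.3)–(28.4). [Huxley1972]
* E. C. Titchmarsh, *The Theory of the Riemann Zeta-Function*, 2nd ed. 1986, Thm. 5.12 (Weyl–Hardy–
  Littlewood `ζ(1/2+it) ≪ t^{1/6} log t`). [Titchmarsh1986]
-/

noncomputable section

open Real Set Filter Topology Complex MeasureTheory Asymptotics

namespace Literature.NumberTheory.LFunctions

namespace NearOneLogPower

open ZeroDetect (mollifier mollCoeff)
open HuxleyZeroDetection (smoothed)

/-! ## §1. Weyl's bound on the window `100 log T ≤ t ≤ 2T` -/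

/-- **Weyl's bound on the detection window.** There are `C ≥ 0` and `T₀` such that
`‖ζ(1/2 + it)‖ ≤ C T^{1/6} log T` whenever `T ≥ T₀` and `100 log T ≤ t ≤ 2T`
(from `‖ζ(1/2+it)‖ ≤ C_W t^{1/6} log t`, `t ≥ t₀`, with `(2T)^{1/6} ≤ 2T^{1/6}` and `log 2T ≤ 2 log T`).
[cite: Titchmarsh1986, Thm 5.12] -/
theorem norm_zeta_half_le_of_weyl_window :
    ∃ C T₀ : ℝ, 0 ≤ C ∧ ∀ T : ℝ, T₀ ≤ T → ∀ t : ℝ, 100 * Real.log T ≤ t → t ≤ 2 * T →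
      ‖riemannZeta (1 / 2 + t * I)‖ ≤ C * T ^ (1 / 6 : ℝ) * Real.log T := by
  obtain ⟨C_W, t₀, hW⟩ := norm_riemannZeta_half_le_weyl
  refine ⟨4 * |C_W|, max (Real.exp (max t₀ 1 / 100)) 2, by positivity, fun T hT t ht1 ht2 ↦ ?_⟩
  have hTe : Real.exp (max t₀ 1 / 100) ≤ T := (le_max_left _ _).trans hT
  have hT2 : 2 ≤ T := (le_max_right _ _).trans hT
  have hT0 : 0 < T := by linarith
  have hlogT : max t₀ 1 / 100 ≤ Real.log T := by
    rw [Real.le_log_iff_exp_le hT0]; exact hTe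
  have ht₀ : t₀ ≤ t := by
    have : max t₀ 1 ≤ 100 * Real.log T := by linarith
    exact (le_max_left _ _).trans (this.trans ht1)
  have ht1' : 1 ≤ t := by
    have : max t₀ 1 ≤ 100 * Real.log T := by linarith
    exact (le_max_right _ _).trans (this.trans ht1)
  have ht0 : 0 < t := by linarith
  have hlog2 : Real.log 2 ≤ Real.log T := Real.log_le_log (by norm_num) hT2
  have hl0 : 0 ≤ Real.log T := le_trans (Real.log_nonneg (by norm_num : (1 : ℝ) ≤ 2)) hlog2
  have ht16 : t ^ (1 / 6 : ℝ) ≤ 2 * T ^ (1 / 6 : ℝ) := by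
    calc t ^ (1 / 6 : ℝ) ≤ (2 * T) ^ (1 / 6 : ℝ) := Real.rpow_le_rpow ht0.le ht2 (by norm_num)
      _ = (2 : ℝ) ^ (1 / 6 : ℝ) * T ^ (1 / 6 : ℝ) := Real.mul_rpow (by norm_num) hT0.le
      _ ≤ 2 * T ^ (1 / 6 : ℝ) := by
          refine mul_le_mul_of_nonneg_right ?_ (by positivity)
          calc (2 : ℝ) ^ (1 / 6 : ℝ) ≤ (2 : ℝ) ^ (1 : ℝ) :=
                Real.rpow_le_rpow_of_exponent_le (by norm_num) (by norm_num)
            _ = 2 := Real.rpow_one 2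
  have hlogt : Real.log t ≤ 2 * Real.log T := by
    calc Real.log t ≤ Real.log (2 * T) := Real.log_le_log ht0 ht2
      _ = Real.log 2 + Real.log T := Real.log_mul (by norm_num) hT0.ne'
      _ ≤ 2 * Real.log T := by linarith
  have hlogt0 : 0 ≤ Real.log t := Real.log_nonneg ht1'
  calc ‖riemannZeta (1 / 2 + t * I)‖ ≤ C_W * t ^ (1 / 6 : ℝ) * Real.log t := hW t ht₀
    _ ≤ |C_W| * t ^ (1 / 6 : ℝ) * Real.log t := by
        have : C_W * t ^ (1 / 6 : ℝ) ≤ |C_W| * t ^ (1 / 6 : ℝ) :=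
          mul_le_mul_of_nonneg_right (le_abs_self _) (by positivity)
        exact mul_le_mul_of_nonneg_right this hlogt0
    _ ≤ |C_W| * (2 * T ^ (1 / 6 : ℝ)) * (2 * Real.log T) :=
        mul_le_mul (mul_le_mul_of_nonneg_left ht16 (abs_nonneg _)) hlogt hlogt0 (by positivity)
    _ = 4 * |C_W| * T ^ (1 / 6 : ℝ) * Real.log T := by ring

/-! ## §2. The short integral of `|ζ M_X|` with `‖M_X(1/2+it)‖ ≤ 2√X` -/

/-- **No class (ii) zeros when `ζ` is small on the window, square-root form**: if
`|ζ(1/2 + i(γ+y))| ≤ B` for `|y| ≤ A` and `2AB·2√X < W₀`, then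
`∫_{-A}^{A} |ζ M_X(1/2 + i(γ+y))| dy < W₀`. This is `HuxleyIvic.integral_zetaMoll_lt` with the bound
`‖M_X(1/2+it)‖ ≤ 2√X` (`GuthMaynardZeroDensity.norm_mollifier_half_le`) in place of `‖M_X‖ ≤ X`
(the pointwise step of Ivić's "class (ii) is empty when `ζ(1/2+it)` is small", Thm. 11.1, proof of
(11.23); Huxley (28.3)–(28.4)). [cite: Ivic1985, Theorem 11.1, proof of (11.23)]
[cite: Huxley1972, Ch. 28, (28.3)–(28.4)] -/
theorem integral_zetaMoll_lt_sqrt {A W₀ B : ℝ} (hA : 0 ≤ A) (X : ℕ) {γ : ℝ}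
    (hB : ∀ y ∈ Set.Icc (-A) A, ‖riemannZeta (1 / 2 + ((γ + y : ℝ) : ℂ) * I)‖ ≤ B)
    (hlt : 2 * A * B * (2 * Real.sqrt X) < W₀) :
    ∫ y in (-A)..A, ‖riemannZeta (1 / 2 + ((γ + y : ℝ) : ℂ) * I) *
        mollifier X (1 / 2 + ((γ + y : ℝ) : ℂ) * I)‖ < W₀ := by
  have hbound : ∀ y ∈ Set.uIoc (-A) A, ‖(‖riemannZeta (1 / 2 + ((γ + y : ℝ) : ℂ) * I) *
      mollifier X (1 / 2 + ((γ + y : ℝ) : ℂ) * I)‖)‖ ≤ B * (2 * Real.sqrt X) := by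
    intro y hy
    rw [Set.uIoc_of_le (by linarith)] at hy
    rw [Real.norm_of_nonneg (norm_nonneg _), norm_mul]
    have hB' := hB y ⟨hy.1.le, hy.2⟩
    refine mul_le_mul hB' (GuthMaynardZeroDensity.norm_mollifier_half_le X (by simp))
      (norm_nonneg _) ((norm_nonneg _).trans hB')
  have h := intervalIntegral.norm_integral_le_of_norm_le_const hbound
  rw [show |A - -A| = 2 * A by rw [abs_of_nonneg (by linarith)]; ring] at h
  calc ∫ y in (-A)..A, ‖riemannZeta (1 / 2 + ((γ + y : ℝ) : ℂ) * I) *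
        mollifier X (1 / 2 + ((γ + y : ℝ) : ℂ) * I)‖
      ≤ ‖∫ y in (-A)..A, ‖riemannZeta (1 / 2 + ((γ + y : ℝ) : ℂ) * I) *
        mollifier X (1 / 2 + ((γ + y : ℝ) : ℂ) * I)‖‖ := Real.le_norm_self _
    _ ≤ B * (2 * Real.sqrt X) * (2 * A) := h
    _ = 2 * A * B * (2 * Real.sqrt X) := by ring
    _ < W₀ := hlt

/-! ## §3. The class (ii) integral is small: general exponents, then `X ≤ 2T^{11/20}`, `Y = T`, `δ = 9/20` -/

/-- **The short integral of `|ζ M_X|` is `< c T^{v}`** (Ivić, Thm. 11.1, proof of (11.23), the step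
"`M(12) ≤ 2`", in Weyl form): if `1/6 + a/2 < v` and `c > 0`, then for `T ≥ T₀(a, v, c)`, every
`X ≤ 2T^{a}` and every height `200 log T ≤ γ ≤ T`,
`∫_{-100 log T}^{100 log T} |ζ(1/2+i(γ+y)) M_X(1/2+i(γ+y))| dy < c T^{v}`.
Proof: on the window `|ζ| ≤ C T^{1/6} log T` (`norm_zeta_half_le_of_weyl_window`),
`‖M_X‖ ≤ 2√X ≤ 4T^{a/2}`, so the integral is `≤ 800 C (log T)² T^{1/6+a/2}`, and
`(log T)² = o(T^{v − 1/6 − a/2})`. [cite: Ivic1985, Theorem 11.1, proof of (11.23)]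
[cite: Titchmarsh1986, Thm 5.12] -/
theorem integral_zetaMoll_lt_of_weyl {a v c : ℝ} (hav : 1 / 6 + a / 2 < v) (hc : 0 < c) :
    ∃ T₀ : ℝ, ∀ T : ℝ, T₀ ≤ T → ∀ X : ℕ, (X : ℝ) ≤ 2 * T ^ a →
      ∀ γ : ℝ, 200 * Real.log T ≤ γ → γ ≤ T →
        ∫ y in (-(100 * Real.log T))..(100 * Real.log T),
            ‖riemannZeta (1 / 2 + ((γ + y : ℝ) : ℂ) * I) *
              mollifier X (1 / 2 + ((γ + y : ℝ) : ℂ) * I)‖ < c * T ^ v := by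
  obtain ⟨C, T₁, hC0, hWin⟩ := norm_zeta_half_le_of_weyl_window
  set ε : ℝ := v - (1 / 6 + a / 2) with hε_def
  have hε : 0 < ε := by rw [hε_def]; linarith
  -- the constant in front of `(log T)²`
  set K : ℝ := 800 * C with hK
  have hK0 : 0 ≤ K := by rw [hK]; positivity
  have hc' : 0 < c / (2 * (K + 1)) := by positivity
  -- `(log T)² ≤ c/(2(K+1)) · T^ε` eventually
  have hlo : ∀ᶠ T : ℝ in atTop, Real.log T ^ 2 ≤ c / (2 * (K + 1)) * T ^ ε := by
    have h := (isLittleO_log_rpow_rpow_atTop (2 : ℝ) hε).def hc'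
    filter_upwards [h, eventually_ge_atTop (1 : ℝ)] with T hT hT1
    have hl0 : 0 ≤ Real.log T := Real.log_nonneg hT1
    rw [Real.rpow_two, Real.norm_of_nonneg (by positivity),
      Real.norm_of_nonneg (Real.rpow_nonneg (by linarith) _)] at hT
    exact hT
  -- `100 log T ≤ T` eventually
  have hlogT : ∀ᶠ T : ℝ in atTop, 100 * Real.log T ≤ T := by
    have h := Real.isLittleO_log_id_atTop.def (by norm_num : (0 : ℝ) < 1 / 100)
    filter_upwards [h, eventually_ge_atTop (1 : ℝ)] with T hT hT1
    rw [Real.norm_of_nonneg (Real.log_nonneg hT1), id, Real.norm_of_nonneg (by linarith)] at hT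
    linarith
  have hev : ∀ᶠ T : ℝ in atTop, ∀ X : ℕ, (X : ℝ) ≤ 2 * T ^ a →
      ∀ γ : ℝ, 200 * Real.log T ≤ γ → γ ≤ T →
        ∫ y in (-(100 * Real.log T))..(100 * Real.log T),
            ‖riemannZeta (1 / 2 + ((γ + y : ℝ) : ℂ) * I) *
              mollifier X (1 / 2 + ((γ + y : ℝ) : ℂ) * I)‖ < c * T ^ v := by
    filter_upwards [hlo, hlogT, eventually_ge_atTop T₁, eventually_ge_atTop (1 : ℝ)]
      with T hloT hlogT' hTT₁ hT1 X hX γ hγ1 hγ2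
    have hT0 : 0 < T := by linarith
    set l : ℝ := Real.log T with hl
    have hl0 : 0 ≤ l := Real.log_nonneg hT1
    have hA0 : 0 ≤ 100 * l := by positivity
    -- Weyl on the window
    have hBound : ∀ y ∈ Set.Icc (-(100 * l)) (100 * l),
        ‖riemannZeta (1 / 2 + ((γ + y : ℝ) : ℂ) * I)‖ ≤ C * T ^ (1 / 6 : ℝ) * l := by
      intro y hy
      obtain ⟨hy1, hy2⟩ := hy
      exact hWin T hTT₁ (γ + y) (by rw [← hl]; linarith) (by linarith)
    -- `2√X ≤ 4 T^{a/2}`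
    have hsqrt : 2 * Real.sqrt X ≤ 4 * T ^ (a / 2) := by
      have hTa : 0 ≤ T ^ (a / 2) := Real.rpow_nonneg hT0.le _
      have h2 : Real.sqrt X ≤ 2 * T ^ (a / 2) := by
        rw [Real.sqrt_le_iff]
        refine ⟨by positivity, ?_⟩
        calc (X : ℝ) ≤ 2 * T ^ a := hX
          _ ≤ 4 * T ^ a := by
              have : 0 ≤ T ^ a := Real.rpow_nonneg hT0.le _
              linarith
          _ = (2 * T ^ (a / 2)) ^ 2 := by
              rw [mul_pow, ← Real.rpow_natCast (T ^ (a / 2)) 2, ← Real.rpow_mul hT0.le]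
              norm_num
      linarith
    -- the numerical inequality
    have hlt : 2 * (100 * l) * (C * T ^ (1 / 6 : ℝ) * l) * (2 * Real.sqrt X) < c * T ^ v := by
      have hTv : T ^ v = T ^ ε * T ^ (1 / 6 + a / 2) := by
        rw [← Real.rpow_add hT0]; congr 1; rw [hε_def]; ring
      have hT16a : T ^ (1 / 6 + a / 2) = T ^ (1 / 6 : ℝ) * T ^ (a / 2) := by
        rw [← Real.rpow_add hT0]
      have hP : 0 < T ^ (1 / 6 + a / 2) := Real.rpow_pos_of_pos hT0 _
      have hTε : 0 < T ^ ε := Real.rpow_pos_of_pos hT0 _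
      calc 2 * (100 * l) * (C * T ^ (1 / 6 : ℝ) * l) * (2 * Real.sqrt X)
          ≤ 2 * (100 * l) * (C * T ^ (1 / 6 : ℝ) * l) * (4 * T ^ (a / 2)) :=
            mul_le_mul_of_nonneg_left hsqrt (by positivity)
        _ = K * l ^ 2 * T ^ (1 / 6 + a / 2) := by rw [hK, hT16a]; ring
        _ ≤ K * (c / (2 * (K + 1)) * T ^ ε) * T ^ (1 / 6 + a / 2) := by gcongr
        _ = (K / (K + 1)) * (c / 2) * (T ^ ε * T ^ (1 / 6 + a / 2)) := by
            field_simp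
        _ < 1 * c * (T ^ ε * T ^ (1 / 6 + a / 2)) := by
            have hKK : K / (K + 1) * (c / 2) < 1 * c := by
              have h1 : K / (K + 1) < 1 := by rw [div_lt_one (by linarith)]; linarith
              nlinarith
            exact mul_lt_mul_of_pos_right hKK (mul_pos hTε hP)
        _ = c * T ^ v := by rw [hTv]; ring
    exact integral_zetaMoll_lt_sqrt hA0 X hBound hlt
  obtain ⟨T₀, hT₀⟩ := Filter.eventually_atTop.1 hev
  exact ⟨T₀, hT₀⟩

/-- **The same on a dyadic block of heights `T/2 < γ ≤ T`** (the form used per block `U < γ ≤ 2U`,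
`T = 2U`): for `T ≥ T₀(a, v, c)`, `T/2 ≥ 200 log T`. [cite: Ivic1985, Theorem 11.1, proof of (11.23)] -/
theorem integral_zetaMoll_lt_of_weyl_block {a v c : ℝ} (hav : 1 / 6 + a / 2 < v) (hc : 0 < c) :
    ∃ T₀ : ℝ, ∀ T : ℝ, T₀ ≤ T → ∀ X : ℕ, (X : ℝ) ≤ 2 * T ^ a →
      ∀ γ : ℝ, T / 2 < γ → γ ≤ T →
        ∫ y in (-(100 * Real.log T))..(100 * Real.log T),
            ‖riemannZeta (1 / 2 + ((γ + y : ℝ) : ℂ) * I) *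
              mollifier X (1 / 2 + ((γ + y : ℝ) : ℂ) * I)‖ < c * T ^ v := by
  obtain ⟨T₁, hT₁⟩ := integral_zetaMoll_lt_of_weyl hav hc
  -- `400 log T ≤ T` eventually
  have hlogT : ∀ᶠ T : ℝ in atTop, 400 * Real.log T ≤ T := by
    have h := Real.isLittleO_log_id_atTop.def (by norm_num : (0 : ℝ) < 1 / 400)
    filter_upwards [h, eventually_ge_atTop (1 : ℝ)] with T hT hT1
    rw [Real.norm_of_nonneg (Real.log_nonneg hT1), id, Real.norm_of_nonneg (by linarith)] at hT
    linarith
  obtain ⟨T₂, hT₂⟩ := Filter.eventually_atTop.1 hlogT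
  refine ⟨max T₁ T₂, fun T hT X hX γ hγ1 hγ2 ↦ ?_⟩
  have h400 := hT₂ T ((le_max_right _ _).trans hT)
  exact hT₁ T ((le_max_left _ _).trans hT) X hX γ (by linarith) hγ2

/-- **Class (ii) is empty near `σ = 1`** (road-B parameters `X ≤ 2T^{11/20}`, `Y = T`, `δ = 9/20`):
for `T ≥ T₀`, every `X ≤ 2T^{11/20}` and every height `T/2 < γ ≤ T`,
`∫_{-100 log T}^{100 log T} |ζ(1/2+i(γ+y)) M_X(1/2+i(γ+y))| dy < (9/20) T^{9/20} / 2²⁰`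
(`1/6 + 11/40 = 53/120 < 54/120 = 9/20`). [cite: Ivic1985, Theorem 11.1, proof of (11.23)]
[cite: Huxley1972, Ch. 28, (28.3)–(28.4)] -/
theorem classTwo_empty_of_weyl :
    ∃ T₀ : ℝ, ∀ T : ℝ, T₀ ≤ T → ∀ X : ℕ, (X : ℝ) ≤ 2 * T ^ (11 / 20 : ℝ) →
      ∀ γ : ℝ, T / 2 < γ → γ ≤ T →
        ∫ y in (-(100 * Real.log T))..(100 * Real.log T),
            ‖riemannZeta (1 / 2 + ((γ + y : ℝ) : ℂ) * I) *
              mollifier X (1 / 2 + ((γ + y : ℝ) : ℂ) * I)‖ < 9 / 20 * T ^ (9 / 20 : ℝ) / 2 ^ 20 := by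
  obtain ⟨T₀, hT₀⟩ := integral_zetaMoll_lt_of_weyl_block (a := 11 / 20) (v := 9 / 20)
    (c := 9 / 20 / 2 ^ 20) (by norm_num) (by norm_num)
  refine ⟨T₀, fun T hT X hX γ hγ1 hγ2 ↦ ?_⟩
  have h := hT₀ T hT X hX γ hγ1 hγ2
  calc _ < 9 / 20 / 2 ^ 20 * T ^ (9 / 20 : ℝ) := h
    _ = 9 / 20 * T ^ (9 / 20 : ℝ) / 2 ^ 20 := by ring

/-- **The class (ii) alternative of `HuxleyZeroDensity.zeroDetection_integral` fails** for
`δ = 9/20`, `Y = T`, `X ≤ 2T^{11/20}`, `β ≥ 19/20`, `T/2 < γ ≤ T`, `T ≥ T₀`: since `T^{β−1/2} ≥ T^{9/20}`.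
[cite: Ivic1985, Theorem 11.1, proof of (11.23)] [cite: Huxley1972, Ch. 28, (28.3)–(28.4)] -/
theorem not_classTwo_of_weyl :
    ∃ T₀ : ℝ, ∀ T : ℝ, T₀ ≤ T → ∀ X : ℕ, (X : ℝ) ≤ 2 * T ^ (11 / 20 : ℝ) →
      ∀ β : ℝ, 19 / 20 ≤ β → ∀ γ : ℝ, T / 2 < γ → γ ≤ T →
        ¬ (9 / 20 * T ^ (β - 1 / 2) / 2 ^ 20 ≤
            ∫ y in (-(100 * Real.log T))..(100 * Real.log T),
              ‖riemannZeta (1 / 2 + ((γ + y : ℝ) : ℂ) * I) *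
                mollifier X (1 / 2 + ((γ + y : ℝ) : ℂ) * I)‖) := by
  obtain ⟨T₀, hT₀⟩ := classTwo_empty_of_weyl
  refine ⟨max T₀ 1, fun T hT X hX β hβ γ hγ1 hγ2 ↦ ?_⟩
  have hT1 : 1 ≤ T := (le_max_right _ _).trans hT
  have h := hT₀ T ((le_max_left _ _).trans hT) X hX γ hγ1 hγ2
  have hpow : T ^ (9 / 20 : ℝ) ≤ T ^ (β - 1 / 2) :=
    Real.rpow_le_rpow_of_exponent_le hT1 (by linarith)
  intro hle
  have : 9 / 20 * T ^ (9 / 20 : ℝ) / 2 ^ 20 ≤ 9 / 20 * T ^ (β - 1 / 2) / 2 ^ 20 := by gcongr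
  linarith

/-- **Every zero of the upper block is of class (i)** (road-B detection): for `T ≥ T₀`, every
`1 ≤ X ≤ 2T^{11/20}` and every zero `ρ = β + iγ` of `ζ` with `β ≥ 19/20`, `T/2 < γ ≤ T`,
`|∑_{X < n ≤ 100 (log T) T} a_X(n) e^{-n/T} n^{-ρ}| > 1/3` — `HuxleyZeroDensity.zeroDetection_integral`
with `δ = 9/20`, `Y = T`, whose second alternative is excluded by `not_classTwo_of_weyl`.
[cite: Huxley1972, Ch. 28, (28.3)–(28.4)] [cite: Ivic1985, Theorem 11.1, proof of (11.23)] -/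
theorem classOne_of_zero :
    ∃ T₀ : ℝ, ∀ T : ℝ, T₀ ≤ T → ∀ X : ℕ, 1 ≤ X → (X : ℝ) ≤ 2 * T ^ (11 / 20 : ℝ) →
      ∀ ρ : ℂ, riemannZeta ρ = 0 → 19 / 20 ≤ ρ.re → T / 2 < ρ.im → ρ.im ≤ T →
        1 / 3 < ‖∑ n ∈ Finset.Ioc X ⌊100 * Real.log T * T⌋₊,
          smoothed (mollCoeff X) T n * (n : ℂ) ^ (-ρ)‖ := by
  obtain ⟨T₁, hT₁⟩ := not_classTwo_of_weyl
  -- `200 log T ≤ T` eventually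
  have hlogT : ∀ᶠ T : ℝ in atTop, 200 * Real.log T ≤ T := by
    have h := Real.isLittleO_log_id_atTop.def (by norm_num : (0 : ℝ) < 1 / 200)
    filter_upwards [h, eventually_ge_atTop (1 : ℝ)] with T hT hT1
    rw [Real.norm_of_nonneg (Real.log_nonneg hT1), id, Real.norm_of_nonneg (by linarith)] at hT
    linarith
  obtain ⟨T₂, hT₂⟩ := Filter.eventually_atTop.1 hlogT
  refine ⟨max (max T₁ T₂) (2 ^ 36 / (9 / 20) + 3), fun T hT X hX1 hX ρ hζ hβ hγ1 hγ2 ↦ ?_⟩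
  have hTT₁ : T₁ ≤ T := le_trans (le_trans (le_max_left _ _) (le_max_left _ _)) hT
  have hTT₂ : T₂ ≤ T := le_trans (le_trans (le_max_right _ _) (le_max_left _ _)) hT
  have hTbig : 2 ^ 36 / (9 / 20) + 3 ≤ T := (le_max_right _ _).trans hT
  have hT10 : 10 ≤ T := by
    have : (0 : ℝ) ≤ 2 ^ 36 / (9 / 20) := by positivity
    nlinarith
  have hT0 : 0 < T := by linarith
  have hT1 : 1 ≤ T := by linarith
  have h200 := hT₂ T hTT₂
  have hγpos : 0 < ρ.im := by linarith
  have habs : |ρ.im| = ρ.im := abs_of_pos hγpos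
  -- `X ≤ 2T^{11/20} ≤ T²`
  have hXT : (X : ℝ) ≤ T ^ 2 := by
    refine hX.trans ?_
    have h1 : T ^ (11 / 20 : ℝ) ≤ T ^ (1 : ℝ) :=
      Real.rpow_le_rpow_of_exponent_le hT1 (by norm_num)
    rw [Real.rpow_one] at h1
    nlinarith
  have hdet := HuxleyZeroDensity.zeroDetection_integral (δ := 9 / 20) (by norm_num) hTbig hX1 hXT
    (Y := T) hT10 (by nlinarith) hζ (by linarith) (by rw [habs]; linarith) (by rw [habs]; exact hγ2)
  rcases hdet with h | h
  · exact h
  · exact absurd h (hT₁ T hTT₁ X hX ρ.re hβ ρ.im hγ1 hγ2)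

/-! ## §4. The zeros of logarithmic height -/

/-- **Zeros of height at most `k log T`**: for every `k > 0` there are `C > 0`, `T₀` with
`N(σ, k log T) ≤ C · log T · log log T` for all `T ≥ T₀` and `σ ≥ 1/4` (from the unconditional
`N(σ, V) ≤ C (V+2) log(V+2)`, `exists_zetaZeroCountRe_le_mul_log`; Jensen / Riemann–von Mangoldt).
[cite: Ivic1985, §11.1] -/
theorem zetaZeroCountRe_logHeight_le {k : ℝ} (hk : 0 < k) :
    ∃ C T₀ : ℝ, 0 < C ∧ ∀ T : ℝ, T₀ ≤ T → ∀ σ : ℝ, 1 / 4 ≤ σ →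
      (zetaZeroCountRe σ (k * Real.log T) : ℝ) ≤ C * Real.log T * Real.log (Real.log T) := by
  obtain ⟨C, hC0, hC⟩ := exists_zetaZeroCountRe_le_mul_log
  refine ⟨2 * C * (k + 2), max (Real.exp (k + 2)) (Real.exp (1 / k)), by positivity,
    fun T hT σ hσ ↦ ?_⟩
  have hTe1 : Real.exp (k + 2) ≤ T := (le_max_left _ _).trans hT
  have hTe2 : Real.exp (1 / k) ≤ T := (le_max_right _ _).trans hT
  have hT0 : 0 < T := lt_of_lt_of_le (Real.exp_pos _) hTe1
  set l : ℝ := Real.log T with hl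
  have hlk2 : k + 2 ≤ l := by rw [hl, Real.le_log_iff_exp_le hT0]; exact hTe1
  have hl1k : 1 / k ≤ l := by rw [hl, Real.le_log_iff_exp_le hT0]; exact hTe2
  have hl2 : 2 ≤ l := by linarith
  have hkl1 : 1 ≤ k * l := by
    have := mul_le_mul_of_nonneg_left hl1k hk.le
    rwa [mul_one_div_cancel hk.ne'] at this
  have hN := hC σ hσ (k * l) hkl1
  -- `k l + 2 ≤ (k+2) l` and `log((k+2) l) ≤ 2 log l`
  have hkl0 : 0 < k * l := by positivity
  have h1 : k * l + 2 ≤ (k + 2) * l := by nlinarith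
  have hlogl0 : 0 < Real.log l := Real.log_pos (by linarith)
  have h2 : Real.log (k * l + 2) ≤ 2 * Real.log l := by
    calc Real.log (k * l + 2) ≤ Real.log ((k + 2) * l) := Real.log_le_log (by positivity) h1
      _ = Real.log (k + 2) + Real.log l := Real.log_mul (by positivity) (by positivity)
      _ ≤ Real.log l + Real.log l :=
          add_le_add (Real.log_le_log (by positivity) hlk2) le_rfl
      _ = 2 * Real.log l := by ring
  calc (zetaZeroCountRe σ (k * l) : ℝ) ≤ C * (k * l + 2) * Real.log (k * l + 2) := hN
    _ ≤ C * ((k + 2) * l) * (2 * Real.log l) := by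
        refine mul_le_mul (mul_le_mul_of_nonneg_left h1 hC0.le) h2
          (Real.log_nonneg (by linarith)) (by positivity)
    _ = 2 * C * (k + 2) * l * Real.log l := by ring

end NearOneLogPower

end Literature.NumberTheory.LFunctions
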